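import Mathlib
import Summits.ResolutionOfSingularities.ResolutionOfSingularities.Theses.HomologicalConductor
import Summits.ResolutionOfSingularities.ResolutionOfSingularities.Theorems.HomologicalConductorNoZenoBirthDefs
import HarnessLib

/-!
# Kill test `SurfaceTermination` (stmt-16488) — THE UNIFORM (R-QH) TARGET: termination of the ca-tower along the WEIGHT
# valuation of a weighted-homogeneous surface germ — DEFS (the typed target `SurfaceTerminationQH`; link theorem in `…RQH.lean`)

[OURS · cell res-hironaka · LADDER-RESOLUTION L ★L-G4 W4.4 · res-L0-w44-lead-1 g7 (lead prover), CHAIN W4.4 v25 lead row (2)]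
AI-written; weaker than expert review; NOT a statement of the manuscript under review (Hironaka 2017). A CANDIDATE TARGET
(`def … : Prop`), never asserted. Counted 0.

WHY THIS IS THE q.h. HABITAT'S SHARE OF THE RESIDUE. The kill-test skeleton of record (line `genus-descent` r8, plan-1) has
one open stub, `stub_initialPairOfConstantGenus` (an eternal constant positive genus along a prime divisor forces an initial
pair). Inside the quasi-homogeneous habitat the lead's K44S-DEMAZURE §11 (tri-1 PASS) shows that a genus-persisting tower along
ANY prime divisor through a q.h. stage coincides ring by ring with the tower along the WEIGHT valuation `W` (the only
non-rational point of `NBl_ca` of a q.h. germ is the elliptic 𝔾_m-fixed point = the `W`-centre); so for q.h. stages the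
residue is exactly «the ca-tower along `W` terminates» — the statement below, which is `SurfaceTermination` RESTRICTED to the
data (A = a weighted-homogeneous presentation, O = its weight valuation ring). DECIDED INSTANCES (kernel or refereed paper):
the cubic cone (res-D-pv-045 `…SurfaceTerminationCubicConeExit`, p545347, kernel), cones over smooth plane curves and every
simple elliptic germ (lead K44S-NONRATIONAL §4, paper, tri-1-refereed), the eight q.h. `p_g = 1` double points E₁₂…W₁₃ and the
`p_g = 2` seed `x²+y³+z¹³` (K44S-DEMAZURE v1.8 §10–§16, engine + kit j282338/j282577, tri-1 PASS), RDPs (classical). OPEN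
CLASSES: `C = ℙ¹` stars with `p_g ≥ 2` as a class, triple points, stars over curves of genus `≥ 1` with arms, small
characteristics. NECESSARY CONDITIONS for a counterexample: K44S-VOLUME §2 (in kernel form: `…Theorems.NoZeno.LatticeVolume`,
p549419) — `deg D_m` strictly increases, `det Λ(T_m) → ∞`.

THE HYPOTHESES (route binders + three presentation clauses, all over Mathlib's `MvPolynomial.IsWeightedHomogeneous`):
(qh1) `A = range (aeval g)` for `g : Fin n → K` with positive weights `w`, and the presentation ideal is `w`-homogeneous
(every weighted-homogeneous component of a relation is a relation); (qh2) `O` is THE WEIGHT VALUATION RING: on non-zero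
weighted-homogeneous elements the value depends on the weighted degree alone and consistently (`v(F)^e = v(G)^d` for
`deg F = d`, `deg G = e`) — with (qh3) this pins `v` on `A` (components of distinct degrees have distinct values, so `v` of a
sum is the value of its lowest non-zero component) and hence on `K = Frac A`; (qh3) the centre is the vertex: `v(gᵢ) < 1`.
No normality is assumed (the tower normalises at step 1, as in `SurfaceTermination`).
-/

namespace Summit.ResolutionOfSingularities.ResolutionOfSingularities.Theorems.SurfaceTermination.RQH

-- single-problem summit: the doubled namespace component `ResolutionOfSingularities` is forced by the layout
set_option linter.dupNamespace false

open Summit.ResolutionOfSingularities.ResolutionOfSingularities.Theses.HomologicalConductor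
open Summit.ResolutionOfSingularities.ResolutionOfSingularities.Theorems.NoZeno.Birth

/-- **(R-QH) UNIFORM TARGET — `SurfaceTermination` along the weight valuation of a weighted-homogeneous surface germ.**
For every prime `p`, fields `k ⊆ K` with `CharP k p`, a valuation ring `O ∋ k` of `K`, and a presentation `g : Fin n → K` with
positive weights `w : Fin n → ℕ` such that `A := range (aeval g)` has `Frac A = K` and Krull dimension `2`, the presentation
ideal is `w`-homogeneous, `O` is the weight valuation ring ((qh2)) centred at the vertex ((qh3)): SOME STAGE OF THE CANONICAL
ca-TOWER `tower O A m` IS REGULAR. The q.h. habitat's exact share of the kill-test residue (module docstring). CANDIDATE, not a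
fact; instances decided so far listed above. [this work] -/
def SurfaceTerminationQH : Prop :=
  ∀ p : ℕ, p.Prime → ∀ (k K : Type) [Field k] [CharP k p] [Field K] [Algebra k K] (O : ValuationSubring K)
    (n : ℕ) (g : Fin n → K) (w : Fin n → ℕ),
    (∀ i, 0 < w i) →
    (∀ c : k, algebraMap k K c ∈ O) →
    IsFractionRing ↥(MvPolynomial.aeval (R := k) g).range K →
    ringKrullDim ↥(MvPolynomial.aeval (R := k) g).range = 2 →
    (∀ F : MvPolynomial (Fin n) k, MvPolynomial.aeval g F = 0 →
      ∀ m : ℕ, MvPolynomial.aeval g (MvPolynomial.weightedHomogeneousComponent w m F) = 0) →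
    (∀ (d e : ℕ) (F G : MvPolynomial (Fin n) k), MvPolynomial.IsWeightedHomogeneous w F d →
      MvPolynomial.IsWeightedHomogeneous w G e → MvPolynomial.aeval g F ≠ 0 → MvPolynomial.aeval g G ≠ 0 →
      O.valuation (MvPolynomial.aeval g F) ^ e = O.valuation (MvPolynomial.aeval g G) ^ d) →
    (∀ i, O.valuation (g i) < 1) →
    ∃ m : ℕ, IsRegularLocalRing ↥(tower O (MvPolynomial.aeval (R := k) g).range m)

end Summit.ResolutionOfSingularities.ResolutionOfSingularities.Theorems.SurfaceTermination.RQH
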